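import Literature.MeasureTheory.Group.PadicIntHaarLinearMaps
import Literature.RingTheory.HenselLemma.PadicSystems
import HarnessLib

/-!
# The volume of the image of a small ball under an étale polynomial map of `ℤ_pⁿ`:
# `vol(F(x₀ + B_r)) = |det J_F(x₀)|_p · vol(B_r)`

Topic `Literature/MeasureTheory/Group`; combines `PadicIntHaarLinearMaps.lean`
(`vol(A·S) = |det A|_p vol(S)` on `ℤ_pⁿ`) with
`Literature/RingTheory/HenselLemma/PadicSystems.lean` (for a polynomial system `F` with
`ℤ_p`-coefficients and `0 ≤ r < |det J_F(x₀)|_p`: `F(x₀ + B_r) = F(x₀) + J_F(x₀)·B_r`, `F`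
injective on `x₀ + B_r`). Everything here is PROVED (no named facts).

* `padicInt_pi_volume_image_eval_closedBall` — **`vol(F(closedBall x₀ r)) = |det J_F(x₀)|_p ·
  vol(closedBall x₀ r)`** for `0 ≤ r < |det J_F(x₀)|_p`: the infinitesimal form of the `p`-adic
  change-of-variables formula `∫_{F(U)} φ = ∫_U φ(F(x)) |det J_F(x)|_p dx` (Igusa, *An introduction
  to the theory of local zeta functions*, §7.4; Weil, *Adeles and algebraic groups*, §2.2), as used
  in the `p`-adic volume computations of Bhargava–Shankar, Ann. of Math. 181 (2015), §3.4
  (Props. 3.11–3.12 of the published version: "the principle of permanence of identities").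
* `padicInt_pi_volume_closedBall_eq` — all closed balls of the same radius in `ℤ_pⁿ` have the same
  volume (translation invariance); `padicInt_pi_injOn_eval_closedBall` re-exported for convenience.

## References

* J.-I. Igusa, *An introduction to the theory of local zeta functions* (2000), §7.4. [folklore]
* M. Bhargava, A. Shankar, Ann. of Math. (2) 181 (2015) 191–242, §3.4 (published numbering).
  [cite: BhargavaShankarAnnals2015, §3.4 (p-adic change of measure; arXiv:1006.1002v2 §2.4 Prop. 2.8)]
-/

noncomputable section

open MeasureTheory Set Metric MvPolynomial Matrix
open scoped ENNReal

namespace Literature.MeasureTheory.Group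

variable {p : ℕ} [Fact p.Prime] {ι : Type*} [Fintype ι]

/-- Translates of the ball: `x₀ + closedBall 0 r = closedBall x₀ r` in `ℤ_pⁿ`. [folklore] -/
theorem padicInt_pi_image_add_closedBall_zero (x₀ : ι → ℤ_[p]) (r : ℝ) :
    (fun h ↦ x₀ + h) '' closedBall (0 : ι → ℤ_[p]) r = closedBall x₀ r := by
  ext x
  simp only [mem_image, mem_closedBall, dist_eq_norm, sub_zero]
  constructor
  · rintro ⟨h, hh, rfl⟩; rwa [add_sub_cancel_left]
  · intro hx; exact ⟨x - x₀, hx, by rw [add_sub_cancel]⟩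

/-- All closed balls of radius `r` in `ℤ_pⁿ` have the same volume (translation invariance of the
Haar measure). [folklore] -/
theorem padicInt_pi_volume_closedBall_eq (x₀ : ι → ℤ_[p]) (r : ℝ) :
    volume (closedBall x₀ r) = volume (closedBall (0 : ι → ℤ_[p]) r) := by
  rw [← padicInt_pi_image_add_closedBall_zero x₀ r, image_add_left, measure_preimage_add]

/-- The volume of a translate of a linear image: `vol(c + A·S) = vol(A·S)`. [folklore] -/
theorem padicInt_pi_volume_image_add_mulVec (c : ι → ℤ_[p]) (A : Matrix ι ι ℤ_[p])
    (S : Set (ι → ℤ_[p])) :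
    volume ((fun z ↦ c + A *ᵥ z) '' S) = volume ((fun z ↦ A *ᵥ z) '' S) := by
  rw [show (fun z ↦ c + A *ᵥ z) = (fun y ↦ c + y) ∘ (fun z ↦ A *ᵥ z) from rfl, image_comp,
    image_add_left, measure_preimage_add]

variable [DecidableEq ι]

/-- **`vol(F(x₀ + B_r)) = |det J_F(x₀)|_p · vol(B_r)`.** Let `F = (F₁,…,Fₙ)` be polynomials in `n`
variables with `ℤ_p`-coefficients, `J = (∂ⱼFᵢ(x₀))` with `det J ≠ 0`, and `0 ≤ r < |det J|_p`.
Then the image of the ball `closedBall x₀ r ⊆ ℤ_pⁿ` under `F` has volume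
`|det J|_p · vol(closedBall x₀ r)`: by Hensel's lemma the image is the translate
`F(x₀) + J·closedBall 0 r` (`Literature.RingTheory.HenselLemma.image_eval_closedBall_eq`), whose
volume is `|det J|_p vol(closedBall 0 r)` (`padicInt_pi_volume_image_mulVec`). [folklore] -/
theorem padicInt_pi_volume_image_eval_closedBall (F : ι → MvPolynomial ι ℤ_[p]) (x₀ : ι → ℤ_[p])
    (hd : (Matrix.of fun i j ↦ eval x₀ (pderiv j (F i))).det ≠ 0) {r : ℝ} (hr : 0 ≤ r)
    (hrd : r < ‖(Matrix.of fun i j ↦ eval x₀ (pderiv j (F i))).det‖) :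
    volume ((fun x : ι → ℤ_[p] ↦ fun i ↦ eval x (F i)) '' closedBall x₀ r) =
      (‖(Matrix.of fun i j ↦ eval x₀ (pderiv j (F i))).det‖₊ : ℝ≥0∞) * volume (closedBall x₀ r) := by
  rw [Literature.RingTheory.HenselLemma.image_eval_closedBall_eq F x₀ hd hr hrd,
    padicInt_pi_volume_image_add_mulVec, padicInt_pi_volume_image_mulVec hd,
    padicInt_pi_volume_closedBall_eq x₀ r]

/-- The same image, described: `F(closedBall x₀ r) = F(x₀) + J·closedBall 0 r`, and `F` is
injective on `closedBall x₀ r` (re-export of the Hensel statements, for the measure-theoretic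
users). [folklore] -/
theorem padicInt_pi_injOn_eval_closedBall (F : ι → MvPolynomial ι ℤ_[p]) (x₀ : ι → ℤ_[p])
    (hd : (Matrix.of fun i j ↦ eval x₀ (pderiv j (F i))).det ≠ 0) {r : ℝ} (hr : 0 ≤ r)
    (hrd : r < ‖(Matrix.of fun i j ↦ eval x₀ (pderiv j (F i))).det‖) :
    InjOn (fun x : ι → ℤ_[p] ↦ fun i ↦ eval x (F i)) (closedBall x₀ r) :=
  Literature.RingTheory.HenselLemma.injOn_eval_closedBall F x₀ hd hr hrd

end Literature.MeasureTheory.Group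

end
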